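import Literature.Analysis.FluidPDE.OnsagerBDSVGluedStressTransport
import HarnessLib

/-!
# The BDSV gluing stage, §4: `BDSV.gluedTripleEstimates` from the commutator estimate (assembly)

Buckmaster–De Lellis–Székelyhidi–Vicol, *Onsager's conjecture for admissible weak solutions*,
CPAM 72 (2019) = arXiv:1701.08678, §4. The named fact `BDSV.gluedTripleEstimates`
(`OnsagerBDSVGluing.lean`: from the mollified triple `(v_ℓ, p_ℓ, R̊_ℓ)` with (2.13)–(2.14) and an
anchored family of exact Euler solutions with the §3 bounds, an Euler–Reynolds triple
`(v̄_q, p̄_q, R̊̄_q)` on `[0,T] × T³` with (2.17)–(2.22)) is here **reduced to the single published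
input not yet proved in the tree**, the commutator estimate `BDSV.commutatorCZBound` (App. D,
Prop. D.1, "a variant of Lemma 1 from [Co2015]"):

* `BDSV.gluedTripleEstimates_of_commutatorCZBound : commutatorCZBound → gluedTripleEstimates`.

The proof is the assembly of §4 as printed: the triple is `BDSV.gluedVel / gluedPres / gluedStress`
of `OnsagerBDSVGluedTriple.lean` for the cut-offs of `OnsagerBDSVCutoffs.lean` with
`n = ⌊T/τ_q⌋` anchors; it is an Euler–Reynolds triple with (2.17)
(`IsGlueFamily.isEulerReynoldsOn_glued`, `….supportedOnGlueIntervals_gluedStress`, §4.2 with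
Prop. 4.1); (2.18)–(2.19) are Prop. 4.2 (`OnsagerBDSVGluedVelocity.lean`), (2.20)–(2.21) are
Prop. 4.3 (`OnsagerBDSVGluedStressSize.lean`, `OnsagerBDSVGluedStressTransport.lean`, with the
Calderón–Zygmund constants of App. C from the proved `BDSV.holderCZBound_holds` and the commutator
constants of App. D from the hypothesis), (2.22) is Prop. 4.4 (`OnsagerBDSVGluedEnergy.lean`).
Thresholds `α₀ = 1`, `a₀ = 2`; the output constant is the sum over `N ≤ N̄` of the explicit
constants of the five estimates. Once `BDSV.commutatorCZBound` is discharged,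
`theorem gluedTripleEstimates_holds : gluedTripleEstimates := gluedTripleEstimates_of_commutatorCZBound commutatorCZBound_holds`.

## References

* T. Buckmaster, C. De Lellis, L. Székelyhidi Jr., V. Vicol, *Onsager's conjecture for admissible
  weak solutions*, Comm. Pure Appl. Math. 72 (2019) 229–274 = arXiv:1701.08678, §4 (§4.1 (4.1)–(4.3),
  §4.2 Prop. 4.1, §4.3 Prop. 4.2, §4.4 Props. 4.3–4.4), §2.5 (2.17)–(2.22), App. C Prop. C.1, App. D
  Prop. D.1.
* P. Constantin, *Local formulas for the hydrodynamic pressure and applications*, Russian Math.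
  Surveys 69 (2014) / arXiv 2013 (the reference [Co2015] of Prop. D.1).
-/

noncomputable section

open MeasureTheory Set Filter Topology Function
open scoped NNReal ENNReal ContDiff

namespace Literature.Analysis.FluidPDE

namespace BDSV

open FunctionSpaces FunctionSpaces.Torus

/-! ## The assembly: `BDSV.gluedTripleEstimates` from the commutator estimate -/

section Assembly

/-- **BDSV §4 from App. D, Prop. D.1**: the named fact `BDSV.gluedTripleEstimates` (§4: the glued
triple `(v̄_q, p̄_q, R̊̄_q)` of §4.1–4.2 is an Euler–Reynolds triple with (2.17)–(2.22), given the
mollified triple with (2.13)–(2.14) and the anchored exact solutions with the §3 bounds) follows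
from the commutator estimate `BDSV.commutatorCZBound` (App. D, Prop. D.1) — everything else in the
printed §4 (the cut-offs (4.1)–(4.3), Prop. 4.1, the Euler–Reynolds system and (2.17), Prop. 4.2,
Prop. 4.3 with "`ℛ curl` is a zero-order operator" = App. C (`BDSV.holderCZBound_holds`),
Prop. 4.4) being proved in the tree (`OnsagerBDSVGluedTriple`, `…GluedVelocity`, `…GluedEnergy`,
`…GluedStressSize`, `…GluedStressTransport`). Thresholds: `α₀ = 1`, `a₀ = 2`; the constant is a
sum of the constants of (2.18)–(2.22) over the orders `N ≤ N̄`. [cite: BuckmasterEtAl2018, §4 (Props. 4.1–4.4) and App. D Prop. D.1] -/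
theorem gluedTripleEstimates_of_commutatorCZBound (hcomm : commutatorCZBound) : gluedTripleEstimates := by
  intro β hβ hβ3 b hb hb'
  refine ⟨1, one_pos, fun α hα hα1 Nbar Cin C₃ => ?_⟩
  have hα' : 0 < Real.toNNReal α := Real.toNNReal_pos.2 hα
  have hα1' : Real.toNNReal α < 1 := Real.toNNReal_lt_one.2 hα1
  have hb1 : 1 ≤ b := hb.le
  have hβ0 : 0 ≤ β := hβ.le
  -- the traceless square as a bilinear map
  obtain ⟨B, hB⟩ := exists_tracelessCLM
  -- Calderón–Zygmund constants (App. C, proved) and commutator constants (App. D, Prop. D.1)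
  have hczex : ∀ m : ℕ, ∃ C : ℝ≥0∞, C ≠ ⊤ ∧ ∀ z : UnitAddTorus (Fin 3) → EuclideanSpace ℝ (Fin 3), IsSmooth z →
      Torus.eContDiffHolderNorm m (Real.toNNReal α) (fun x => Torus.antidivergence (curl z) x) ≤
        C * Torus.eContDiffHolderNorm m (Real.toNNReal α) z :=
    fun m => holderCZBound_holds.antidivergence_curl_le hα' hα1' m
  choose Ccz hCczT hCcz using hczex
  have hcmex : ∀ m : ℕ, ∃ C : ℝ≥0∞, C ≠ ⊤ ∧ ∀ bb z : UnitAddTorus (Fin 3) → EuclideanSpace ℝ (Fin 3), IsSmooth bb → IsSmooth z →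
      Torus.eContDiffHolderNorm m (Real.toNNReal α)
          (fun x => FunctionSpaces.Torus.convect bb (fun y => Torus.antidivergence (curl z) y) x -
            Torus.antidivergence (curl (FunctionSpaces.Torus.convect bb z)) x) ≤
        C * (Torus.eContDiffHolderNorm 1 (Real.toNNReal α) bb * Torus.eContDiffHolderNorm m (Real.toNNReal α) z +
          Torus.eContDiffHolderNorm (m + 1) (Real.toNNReal α) bb * Torus.eContDiffHolderNorm 0 (Real.toNNReal α) z) :=
    fun m => hcomm.antidivergence_curl_le hα' hα1' m
  choose Ccm hCcmT hCcm using hcmex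
  -- one Calderón–Zygmund constant for all orders `≤ N̄ + 2`
  set Cz : ℝ≥0∞ := ∑ m ∈ Finset.range (Nbar + 3), Ccz m with hCzdef
  have hCzT : Cz ≠ ⊤ := ENNReal.sum_ne_top.2 fun m _ => hCczT m
  have hCz : ∀ m : ℕ, m ≤ Nbar + 2 → ∀ z : UnitAddTorus (Fin 3) → EuclideanSpace ℝ (Fin 3), IsSmooth z →
      Torus.eContDiffHolderNorm m (Real.toNNReal α) (fun x => Torus.antidivergence (curl z) x) ≤
        Cz * Torus.eContDiffHolderNorm m (Real.toNNReal α) z := by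
    intro m hm z hz
    refine (hCcz m z hz).trans (mul_le_mul' ?_ le_rfl)
    exact Finset.single_le_sum (f := Ccz) (fun _ _ => bot_le) (Finset.mem_range.2 (by omega))
  -- the constants of (2.20) and (2.21) at each order
  set K20 : ℕ → ℝ≥0∞ := fun N =>
    ENNReal.ofReal (stepProfileBound 1 * |C₃|) * Cz + 3 ^ N * ‖B‖ₑ * ((N + 1 : ℕ) * ENNReal.ofReal (4 * C₃ ^ 2)) with hK20
  set K21 : ℕ → ℝ≥0∞ := fun N =>
    Cz * ENNReal.ofReal ((stepProfileBound 2 + stepProfileBound 1) * |C₃|) +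
      Ccm N * ENNReal.ofReal (stepProfileBound 1 *
        ((((0 : ℕ) : ℝ) + 4) * |Cin 0| + |Cin (0 + 1)| + ((((N : ℕ) : ℝ) + 4) * |Cin N| + |Cin (N + 1)|)) * |C₃|) +
      3 ^ N * ‖B‖ₑ * ((N + 1 : ℕ) * ENNReal.ofReal (8 * (stepProfileBound 1 + 1) * C₃ ^ 2)) +
      3 ^ N * ((N + 1 : ℕ) * ENNReal.ofReal |C₃|) *
        (ENNReal.ofReal (stepProfileBound 1 * |C₃|) * Cz + 3 ^ (N + 1) * ‖B‖ₑ * ((N + 1 + 1 : ℕ) * ENNReal.ofReal (4 * C₃ ^ 2)))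
    with hK21
  have hK20T : ∀ N, K20 N ≠ ⊤ := fun N => stressSizeConst_ne_top B C₃ hCzT N
  have hK21T : ∀ N, K21 N ≠ ⊤ := by
    intro N
    have h3 : ∀ k : ℕ, (3 : ℝ≥0∞) ^ k ≠ ⊤ := fun k => ENNReal.pow_ne_top (by norm_num)
    refine ENNReal.add_ne_top.2 ⟨ENNReal.add_ne_top.2 ⟨ENNReal.add_ne_top.2 ⟨?_, ?_⟩, ?_⟩, ?_⟩
    · exact ENNReal.mul_ne_top hCzT ENNReal.ofReal_ne_top
    · exact ENNReal.mul_ne_top (hCcmT N) ENNReal.ofReal_ne_top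
    · exact ENNReal.mul_ne_top (ENNReal.mul_ne_top (h3 N) enorm_ne_top) (ENNReal.mul_ne_top (ENNReal.natCast_ne_top _) ENNReal.ofReal_ne_top)
    · exact ENNReal.mul_ne_top (ENNReal.mul_ne_top (h3 N) (ENNReal.mul_ne_top (ENNReal.natCast_ne_top _) ENNReal.ofReal_ne_top))
        (stressSizeConst_ne_top B C₃ hCzT (N + 1))
  -- the output constant
  set C : ℝ := |C₃| + (∑ N ∈ Finset.range (Nbar + 1), (|Cin N| + 3 * |C₃|)) +
    (∑ N ∈ Finset.range (Nbar + 1), (K20 N).toReal) + (∑ N ∈ Finset.range (Nbar + 1), (K21 N).toReal) +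
    (6 * Cin 0 ^ 2 + 4 * C₃ ^ 2) with hCdef
  have hS19 : 0 ≤ ∑ N ∈ Finset.range (Nbar + 1), (|Cin N| + 3 * |C₃|) := Finset.sum_nonneg fun _ _ => by positivity
  have hS20 : 0 ≤ ∑ N ∈ Finset.range (Nbar + 1), (K20 N).toReal := Finset.sum_nonneg fun _ _ => ENNReal.toReal_nonneg
  have hS21 : 0 ≤ ∑ N ∈ Finset.range (Nbar + 1), (K21 N).toReal := Finset.sum_nonneg fun _ _ => ENNReal.toReal_nonneg
  have hC18 : |C₃| ≤ C := by rw [hCdef]; nlinarith [abs_nonneg C₃, sq_nonneg (Cin 0), sq_nonneg C₃]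
  have hC19 : ∀ N : ℕ, N ≤ Nbar → |Cin N| + 3 * |C₃| ≤ C := by
    intro N hN
    have h1 : |Cin N| + 3 * |C₃| ≤ ∑ N ∈ Finset.range (Nbar + 1), (|Cin N| + 3 * |C₃|) :=
      Finset.single_le_sum (f := fun N => |Cin N| + 3 * |C₃|) (fun _ _ => by positivity) (Finset.mem_range.2 (Nat.lt_succ_of_le hN))
    rw [hCdef]; nlinarith [abs_nonneg C₃, sq_nonneg (Cin 0), sq_nonneg C₃]
  have hC20 : ∀ N : ℕ, N ≤ Nbar → (K20 N).toReal ≤ C := by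
    intro N hN
    have h1 : (K20 N).toReal ≤ ∑ N ∈ Finset.range (Nbar + 1), (K20 N).toReal :=
      Finset.single_le_sum (f := fun N => (K20 N).toReal) (fun _ _ => ENNReal.toReal_nonneg) (Finset.mem_range.2 (Nat.lt_succ_of_le hN))
    rw [hCdef]; nlinarith [abs_nonneg C₃, sq_nonneg (Cin 0), sq_nonneg C₃]
  have hC21 : ∀ N : ℕ, N ≤ Nbar → (K21 N).toReal ≤ C := by
    intro N hN
    have h1 : (K21 N).toReal ≤ ∑ N ∈ Finset.range (Nbar + 1), (K21 N).toReal :=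
      Finset.single_le_sum (f := fun N => (K21 N).toReal) (fun _ _ => ENNReal.toReal_nonneg) (Finset.mem_range.2 (Nat.lt_succ_of_le hN))
    rw [hCdef]; nlinarith [abs_nonneg C₃, sq_nonneg (Cin 0), sq_nonneg C₃]
  have hC22 : 6 * Cin 0 ^ 2 + 4 * C₃ ^ 2 ≤ C := by rw [hCdef]; nlinarith [abs_nonneg C₃]
  refine ⟨C, 2, one_lt_two, fun a ha T hT q vℓ pℓ Rℓ hER h213 h214 v p hfam hpot => ?_⟩
  have ha1 : 1 ≤ a := by linarith
  -- the anchored family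
  set τ := glueScale β α a b q with hτdef
  have hτ : 0 < τ := glueScale_pos ha1 q
  set n : ℕ := ⌊T / τ⌋₊ with hndef
  have hn : (n : ℝ) * τ ≤ T := by
    have := Nat.floor_le (div_nonneg hT.le hτ.le)
    rwa [le_div_iff₀ hτ] at this
  have hn' : T < ((n : ℝ) + 1) * τ := by
    have := Nat.lt_floor_add_one (T / τ)
    rwa [div_lt_iff₀ hτ] at this
  have hglue : IsGlueFamily T τ n vℓ pℓ Rℓ v p :=
    { hT := hT
      hτ := hτ
      hn := hn
      hn' := hn'
      er := hER
      exact := fun i hi => (hfam i hi).1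
      anchor := fun i hi => (hfam i hi).2.1 }
  have hS : ∀ i : ℕ, i ≤ n → StabilityBounds β α a b T C₃ q (Nbar + 2) i vℓ pℓ (v i) (p i) :=
    fun i hi => (hfam i (hglue.anchor_le hi)).2.2
  have hP : ∀ i : ℕ, i < n → PotentialBounds β α a b T C₃ q (Nbar + 2) i vℓ (v i) (v (i + 1)) :=
    fun i hi => hpot i (hglue.anchor_le (Nat.succ_le_of_lt hi))
  -- positivity of the parameter expressions
  have hℓ : 0 < mollScale β α a b q := mollScale_pos ha1 q
  have hδ : 0 < amp β a b (q + 1) := amp_pos ha1 (q + 1)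
  have hfreq : 0 < freq a b q := freq_pos ha1 q
  have hamp : 0 < amp β a b q := amp_pos ha1 q
  refine ⟨gluedVel τ n v, gluedPres τ n v p, gluedStress τ n v, hglue.isEulerReynoldsOn_glued,
    hglue.supportedOnGlueIntervals_gluedStress, ?_, ?_, ?_, ?_, ?_⟩
  · -- (2.18)
    refine (hglue.supLE_gluedVel_sub hS ha1 hb1 hβ0 hα.le).mono ?_
    exact mul_le_mul_of_nonneg_right hC18 (by positivity)
  · -- (2.19)
    intro N hN
    refine (hglue.holderSupLE_gluedVel hS ha1 hb1 hβ0 hα.le h213 (show N + 1 ≤ Nbar + 2 by omega)).mono ?_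
    exact mul_le_mul_of_nonneg_right (hC19 N hN) (by positivity)
  · -- (2.20)
    intro N hN
    refine (hglue.holderSupLE_gluedStress hB hS hP ha1 hb1 hβ0 hα.le (show N ≤ Nbar + 2 by omega) hCzT (hCz N (by omega))).mono ?_
    exact mul_le_mul_of_nonneg_right (hC20 N hN) (by positivity)
  · -- (2.21)
    intro N hN t ht
    have hmain := hglue.eContDiffHolderNorm_advectiveDeriv_gluedStress_le hB hS hP ha1 hb1 hβ0 hα hα1 h213
      (show N + 1 ≤ Nbar + 2 by omega) (Ccz := Cz) (Ccm := Ccm N) (fun m hm => hCz m (by omega)) (hCcm N) ht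
    refine hmain.trans ?_
    rw [mul_ofReal_eq_ofReal_toReal_mul (hK21T N)]
    exact ENNReal.ofReal_le_ofReal (mul_le_mul_of_nonneg_right (hC21 N hN) (by positivity))
  · -- (2.22)
    intro t ht
    refine (hglue.abs_energy_gluedVel_sub_le hS ha1 hb1 hβ0 hα.le h213 h214 ht).trans ?_
    exact mul_le_mul_of_nonneg_right hC22 (by positivity)

end Assembly

end BDSV

end Literature.Analysis.FluidPDE
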